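import Summits.Ventures.LatticeQCDFlow.Scoring.ChainWindowFunctionalSLLN
import Summits.Ventures.LatticeQCDFlow.Scoring.SampleACFSumZero

/-!
# THE SCORER'S WINDOW FREEZES ON CHAIN DATA: scorer A's `gammaHat`, `rhoHat` and windowed `τ_int` of a
# bounded observable along a chain with a Doeblin power are ALMOST SURELY consistent from EVERY initial
# law, and scorer B's data-chosen Madras–Sokal window equals the population window for all large `N`

HONEST FRAMING: exact (Metropolis-corrected) sampling algorithms for lattice gauge theory;
figures of merit are autocorrelation/cost numbers at stated couplings and volumes; no
continuum-physics claim.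

Venture `LatticeQCDFlow` (cell pub-lqcd), sub-topic `Scoring`; FANOUT row 16 (`su2-base`), GEN-9.
NEW WORK of the cell, not a published result; no definition; nothing is cited as a fact.  The
almost-sure strengthening of GEN-8's `Scoring/ChainMadrasSokalDataWindow` (`P_{μ₀}(Ŵ_N ≠ w) → 0`) and the
MARKOV-CHAIN COUNTERPART of GEN-8's `Scoring/BlockFactorStrongLawCentred`: from GEN-9's every-start strong
law for window functionals (`Scoring/ChainWindowFunctionalSLLN`) and the exact expansion of the
sample-mean-centred estimator, scorer A's own statistics (`Scoring/SampleACFSumZero.gammaHat`, `rhoHat`,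
`tauIntWindow (rhoHat …) W`) converge almost surely along the chain from every initial law, and by GEN-8's
abstract freezing lemma (`BlockFactorStrongLaw.ae_eventually_windowSel_eq`) any admissible selector —
scorer B's `ms_window` with `w ≤ W_max` — equals the strict population window `w` for all large `N`,
almost surely: eventually the printed `τ_int` IS the fixed-window statistic `τ̂_N(w)`.

## Content (`κ` Markov, `π` invariant, `(nHit κ m)(z,·) ≥ ε ν` for all `z`, `ε ≠ 0`; `|f| ≤ C` measurable,
## `f̄ = f − ∫ f dπ`, `C(t) = autocov κ π f̄ t`; `y_i = f(x_i)` the observed series; `μ₀` ANY initial law)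

* `gammaHat_sub_const` — shift invariance `gammaHat (y − a) N t = gammaHat y N t` (`N ≠ 0`);
  `gammaHat_expand` — for `t < N`: `gammaHat z N t = A_N(t) − z̄_N · B_N(t) + z̄_N²` with
  `A_N(t) = (Σ_{i<N−t} z_i z_{i+t})/(N−t)`, `B_N(t) = (Σ_{i<N−t} (z_i + z_{i+t}))/(N−t)`, `z̄_N` the sample mean;
* **`ae_tendsto_chain_gammaHat_of_nHit`** — `gammaHat (f ∘ x) N t → C(t)` `P_{μ₀}`-a.s., every `t`;
* **`ae_tendsto_chain_scorer_tauIntWindow_of_nHit`** — `C(0) ≠ 0`: a.s., for EVERY `W` at once,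
  `tauIntWindow (rhoHat (f ∘ x) N) W → τ_W`;
* **`ae_eventually_scorer_windowSel_eq_chain_of_nHit`** — strict population window `w` at `c > 0`, selector
  `Ŵ_N` returning `w` whenever `w` is the MS window of the empirical curve: a.s. `Ŵ_N = w` eventually.

NOT CLAIMED: rates; unbounded `f`; tangential crossings.
-/

noncomputable section

open MeasureTheory ProbabilityTheory Filter Finset Preorder
open scoped ENNReal Topology
open Summit.Ventures.LatticeQCDFlow.Exactness Summit.Ventures.LatticeQCDFlow.Exactness.GeneralNCMC

namespace Summit.Ventures.LatticeQCDFlow.Scoring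

/-! ## Algebra of scorer A's centred estimator -/

section Algebra

/-- Shift invariance: subtracting a constant from the series does not change `gammaHat` (`N ≠ 0`). -/
theorem gammaHat_sub_const (y : ℕ → ℝ) (a : ℝ) {N : ℕ} (hN : N ≠ 0) (t : ℕ) :
    gammaHat (fun i => y i - a) N t = gammaHat y N t := by
  have hNR : (N : ℝ) ≠ 0 := by exact_mod_cast hN
  have hmean : sampleMean (fun i => y i - a) N = sampleMean y N - a := by
    simp only [sampleMean, sum_sub_distrib, sum_const, card_range, nsmul_eq_mul]
    field_simp
  have hdev : ∀ i, dev (fun i => y i - a) N i = dev y N i := fun i => by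
    simp only [dev, hmean]; ring
  simp only [gammaHat, acovSum, lagSum, hdev]

/-- **Exact expansion of scorer A's estimator** (`t < N`):
`gammaHat z N t = (Σ_{i<N−t} z_i z_{i+t})/(N−t) − z̄_N · (Σ_{i<N−t} (z_i + z_{i+t}))/(N−t) + z̄_N²`. -/
theorem gammaHat_expand (z : ℕ → ℝ) {N t : ℕ} (ht : t < N) :
    gammaHat z N t
      = (∑ i ∈ range (N - t), z i * z (i + t)) / ((N - t : ℕ) : ℝ)
        - sampleMean z N * ((∑ i ∈ range (N - t), (z i + z (i + t))) / ((N - t : ℕ) : ℝ))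
        + sampleMean z N ^ 2 := by
  have hNt : (0 : ℝ) < ((N - t : ℕ) : ℝ) := by exact_mod_cast Nat.sub_pos_of_lt ht
  have hexp : ∑ i ∈ range (N - t), (z i - sampleMean z N) * (z (i + t) - sampleMean z N)
      = ∑ i ∈ range (N - t), z i * z (i + t)
        - sampleMean z N * ∑ i ∈ range (N - t), (z i + z (i + t))
        + ((N - t : ℕ) : ℝ) * sampleMean z N ^ 2 := by
    rw [mul_sum, ← sum_sub_distrib]
    have : ∀ i ∈ range (N - t), (z i - sampleMean z N) * (z (i + t) - sampleMean z N)
        = (z i * z (i + t) - sampleMean z N * (z i + z (i + t))) + sampleMean z N ^ 2 :=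
      fun i _ => by ring
    rw [sum_congr rfl this, sum_add_distrib, sum_const, card_range, nsmul_eq_mul]
  simp only [gammaHat, acovSum, lagSum, dev]
  rw [hexp]
  field_simp

end Algebra

/-! ## Almost-sure consistency of the scorer's statistics along the chain -/

section Chain

variable {S : Type*} [MeasurableSpace S]
variable (κ : Kernel S S) [IsMarkovKernel κ] {π : Measure S} [IsProbabilityMeasure π]
  {ν : Measure S} [IsProbabilityMeasure ν] {ε : ℝ≥0∞} {m : ℕ}

/-- **`gammaHat (f ∘ x) N t → C(t)` almost surely, from every initial law.** -/
theorem ae_tendsto_chain_gammaHat_of_nHit (hπ : Kernel.Invariant κ π) (hε : ε ≠ 0)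
    (hmin : ∀ z, ε • ν ≤ nHit κ m z) {f : S → ℝ} (hf : Measurable f) {C : ℝ} (hC : ∀ z, |f z| ≤ C)
    (μ₀ : Measure S) [IsProbabilityMeasure μ₀] (t : ℕ) :
    ∀ᵐ x ∂(Kernel.trajMeasure (X := fun _ : ℕ => S) μ₀
        (fun n : ℕ => κ.comap (fun hh : (i : ↥(Finset.Iic n)) → S => hh ⟨n, Finset.mem_Iic.2 le_rfl⟩)
          (measurable_pi_apply _))),
      Tendsto (fun N : ℕ => gammaHat (fun i => f (x i)) N t) atTop
        (𝓝 (autocov κ π (fun z => f z - ∫ z', f z' ∂π) t)) := by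
  obtain ⟨hgm, hgC, hg0⟩ := centred_observable_bounds π hf hC
  -- (1) lag products `A_K → C(t)` along `K`, (2) sample means of `f̄` `→ 0`
  have hA := ae_tendsto_chain_acovHat_of_nHit κ hπ hε hmin hf hC μ₀ t
  have hMean := tendsto_sum_div_anyLaw_of_nHit_minorised (κ := κ) hπ hε hmin hgm
    (integrable_of_bounded π hgm hgC) μ₀
  rw [hg0] at hMean
  filter_upwards [hA, hMean] with x hAx hMx
  set z : ℕ → ℝ := fun i => f (x i) - ∫ z', f z' ∂π with hz
  -- along `K = N − t`
  have hsub := tendsto_sub_atTop_nat t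
  have hA' : Tendsto (fun N : ℕ => (∑ i ∈ range (N - t), z i * z (i + t)) / ((N - t : ℕ) : ℝ)) atTop
      (𝓝 (autocov κ π (fun z => f z - ∫ z', f z' ∂π) t)) := by
    refine (hAx.comp hsub).congr fun N => ?_
    simp only [Function.comp, acovHat_apply, hz]
  have hMean' : Tendsto (fun N : ℕ => sampleMean z N) atTop (𝓝 0) := by
    refine hMx.congr fun N => ?_
    simp only [sampleMean, hz]
  -- the bounded middle factor
  have hC0 : 0 ≤ C := (abs_nonneg _).trans (hC (x 0))
  have hB : ∀ N, |(∑ i ∈ range (N - t), (z i + z (i + t))) / ((N - t : ℕ) : ℝ)| ≤ 2 * C + 2 * C := by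
    intro N
    rcases Nat.eq_zero_or_pos (N - t) with hK | hK
    · rw [hK]
      simp only [sum_range_zero, Nat.cast_zero, div_zero, abs_zero]
      linarith
    · rw [abs_div, Nat.abs_cast, div_le_iff₀ (Nat.cast_pos.2 hK)]
      calc |∑ i ∈ range (N - t), (z i + z (i + t))|
          ≤ ∑ i ∈ range (N - t), |z i + z (i + t)| := abs_sum_le_sum_abs _ _
        _ ≤ ∑ _i ∈ range (N - t), (2 * C + 2 * C) :=
            sum_le_sum fun i _ => (abs_add_le _ _).trans (add_le_add (hgC _) (hgC _))
        _ = (2 * C + 2 * C) * ((N - t : ℕ) : ℝ) := by rw [sum_const, card_range, nsmul_eq_mul, mul_comm]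
  have hmid : Tendsto (fun N : ℕ => sampleMean z N
      * ((∑ i ∈ range (N - t), (z i + z (i + t))) / ((N - t : ℕ) : ℝ))) atTop (𝓝 0) := by
    refine squeeze_zero_norm (a := fun N => |sampleMean z N| * (2 * C + 2 * C)) (fun N => ?_) ?_
    · rw [Real.norm_eq_abs, abs_mul]
      exact mul_le_mul_of_nonneg_left (hB N) (abs_nonneg _)
    · have h := (continuous_abs.tendsto 0).comp hMean'
      rw [abs_zero] at h
      simpa using h.mul_const (2 * C + 2 * C)
  have hlim : Tendsto (fun N : ℕ => (∑ i ∈ range (N - t), z i * z (i + t)) / ((N - t : ℕ) : ℝ)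
      - sampleMean z N * ((∑ i ∈ range (N - t), (z i + z (i + t))) / ((N - t : ℕ) : ℝ))
      + sampleMean z N ^ 2) atTop
      (𝓝 (autocov κ π (fun z => f z - ∫ z', f z' ∂π) t - 0 + 0 ^ 2)) :=
    (hA'.sub hmid).add (hMean'.pow 2)
  simp only [sub_zero, zero_pow two_ne_zero, add_zero] at hlim
  refine hlim.congr' ?_
  filter_upwards [eventually_gt_atTop t] with N hN
  have hN0 : N ≠ 0 := by omega
  rw [← gammaHat_sub_const (fun i => f (x i)) (∫ z', f z' ∂π) hN0 t, gammaHat_expand z hN]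

/-- **`tauIntWindow (rhoHat (f ∘ x) N) W → τ_W` almost surely, for EVERY window at once, from every
initial law** (`C(0) ≠ 0`). -/
theorem ae_tendsto_chain_scorer_tauIntWindow_of_nHit (hπ : Kernel.Invariant κ π) (hε : ε ≠ 0)
    (hmin : ∀ z, ε • ν ≤ nHit κ m z) {f : S → ℝ} (hf : Measurable f) {C : ℝ} (hC : ∀ z, |f z| ≤ C)
    (hσ : autocov κ π (fun z => f z - ∫ z', f z' ∂π) 0 ≠ 0) (μ₀ : Measure S) [IsProbabilityMeasure μ₀] :
    ∀ᵐ x ∂(Kernel.trajMeasure (X := fun _ : ℕ => S) μ₀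
        (fun n : ℕ => κ.comap (fun hh : (i : ↥(Finset.Iic n)) → S => hh ⟨n, Finset.mem_Iic.2 le_rfl⟩)
          (measurable_pi_apply _))),
      ∀ W : ℕ, Tendsto (fun N : ℕ => tauIntWindow (rhoHat (fun i => f (x i)) N) W) atTop
        (𝓝 (tauIntWindow (fun t => autocov κ π (fun z => f z - ∫ z', f z' ∂π) t
          / autocov κ π (fun z => f z - ∫ z', f z' ∂π) 0) W)) := by
  have hall := ae_all_iff.2 fun t : ℕ => ae_tendsto_chain_gammaHat_of_nHit κ hπ hε hmin hf hC μ₀ t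
  filter_upwards [hall] with x hx
  intro W
  have hρ : ∀ t, Tendsto (fun N : ℕ => rhoHat (fun i => f (x i)) N t) atTop
      (𝓝 (autocov κ π (fun z => f z - ∫ z', f z' ∂π) t
        / autocov κ π (fun z => f z - ∫ z', f z' ∂π) 0)) := fun t => by
    simp only [rhoHat]
    exact (hx t).div (hx 0) hσ
  unfold tauIntWindow
  exact tendsto_const_nhds.add (tendsto_finsetSum _ fun t _ => hρ (t + 1))

/-- **THE SCORER'S WINDOW FREEZES ALMOST SURELY ON CHAIN DATA.**  If the population curve
`W ↦ τ_W = tauIntWindow (C(·)/C(0)) W` has a STRICT Madras–Sokal window `w` at `c > 0` and `Ŵ_N` is any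
selector returning `w` whenever `w` is the MS window of the empirical curve
`W ↦ tauIntWindow (rhoHat (f ∘ x) N) W` (scorer B's `ms_window` with `w ≤ W_max`), then from EVERY initial
law, almost surely `Ŵ_N = w` for all large `N`. -/
theorem ae_eventually_scorer_windowSel_eq_chain_of_nHit (hπ : Kernel.Invariant κ π) (hε : ε ≠ 0)
    (hmin : ∀ z, ε • ν ≤ nHit κ m z) {f : S → ℝ} (hf : Measurable f) {C : ℝ} (hC : ∀ z, |f z| ≤ C)
    (hσ : autocov κ π (fun z => f z - ∫ z', f z' ∂π) 0 ≠ 0) {c : ℝ} (hc : 0 < c) {w : ℕ}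
    (hw : IsStrictMSWindow c (fun W => tauIntWindow (fun t =>
      autocov κ π (fun z => f z - ∫ z', f z' ∂π) t / autocov κ π (fun z => f z - ∫ z', f z' ∂π) 0) W) w)
    {Wsel : ℕ → (ℕ → S) → ℕ}
    (hsel : ∀ N x, IsMSWindow c (fun W => tauIntWindow (rhoHat (fun i => f (x i)) N) W) w → Wsel N x = w)
    (μ₀ : Measure S) [IsProbabilityMeasure μ₀] :
    ∀ᵐ x ∂(Kernel.trajMeasure (X := fun _ : ℕ => S) μ₀
        (fun n : ℕ => κ.comap (fun hh : (i : ↥(Finset.Iic n)) → S => hh ⟨n, Finset.mem_Iic.2 le_rfl⟩)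
          (measurable_pi_apply _))),
      ∀ᶠ N in atTop, Wsel N x = w :=
  ae_eventually_windowSel_eq
    (τhat := fun (N W : ℕ) (x : ℕ → S) => tauIntWindow (rhoHat (fun i => f (x i)) N) W) hc hw
    (ae_tendsto_chain_scorer_tauIntWindow_of_nHit κ hπ hε hmin hf hC hσ μ₀) hsel

end Chain

end Summit.Ventures.LatticeQCDFlow.Scoring

end
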